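import Mathlib
import Summits.AnomalousDissipation.AnomalousDissipation.Theorems.DyadicWallCascadeHalfSpaceHierarchySlabOfBand
import Summits.AnomalousDissipation.AnomalousDissipation.Theorems.DyadicWallCascadeHalfSpaceHierarchySlabExtension
import Summits.AnomalousDissipation.AnomalousDissipation.Theorems.DyadicWallCascadeHalfSpaceHierarchyFluxHeightInvariance
import Summits.AnomalousDissipation.AnomalousDissipation.Theorems.DyadicWallCascadeHalfSpaceHierarchyHalfScaleTrace
import Summits.AnomalousDissipation.AnomalousDissipation.Theorems.DyadicWallCascadeHalfSpaceHierarchyCellToBand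
import Summits.AnomalousDissipation.AnomalousDissipation.Theorems.HalfSpaceHierarchy.Negative.XIndependent

/-!
# No `x`-independent cell junction
# (negative tool stub `stub_noXIndependentCellJunction` of the line `bernoulli-surface-topology`,
# crux `DyadicWallCascade.HalfSpaceHierarchy`, item stmt-AnomalousDissipation-18627)

The line `bernoulli-surface-topology` reduces the crux `HalfSpaceHierarchy` (a bounded smooth steady Euler hierarchy
on the half-space `{z > 0}` with `V (2X) = V X`, band-periodic, zero mass flux, energy flux `F ≠ 0`) to a CELL
JUNCTION (`stub_cellJunction` of the lead's skeleton): an entire smooth doubly periodic steady Euler conduit array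
`(G, PG)` with zero mass flux and energy flux `F ≠ 0` per cell, plus a cell solution `(U, P)` on the slab
`{1-η < z < 2+η}` which is `(G, PG)` on the top collar `{2-η < z < 2+η}` and `(G, PG) ∘ (2 •)` on the bottom collar
`{1-η < z < 1+η}`.

**Statement (registered, negative tool).**  There is NO such cell junction whose cell solution `(U, P)` is
independent of `x` on the slab (`U (X + t e₀) = U X`, `P (X + t e₀) = P X` for `1-η < X₃ < 2+η`): junctions of
`2½`-D (sheet) type do not exist — a design constraint for `stub_cellJunction`.

**Proof.**  The reduction cell junction ⇒ crux is EXPLICIT and commutes with horizontal translations: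
* the consumed-form fluxes of the conduit array at the bottom trace come from `stub_fluxHeightInvariance`
  (heights `0` and `2`) and `stub_halfScaleTrace` (file `…FluxHeightInvariance.lean`, `…HalfScaleTrace.lean`);
* the three-piece gluing `V := U (2 •)` on `{z < 1}`, `U` on `{1 ≤ z ≤ 2}`, `U (2⁻¹ •)` on `{2 < z}` (and `Q` from
  `P`) is a band profile (helpers `cellToBand_*` of `…CellToBand.lean`, re-run here with the witnesses in scope), and
  it is `x`-independent on the slab `{1/2 < z < 4}` (`noXCell_glue_invariant`: a horizontal translate has the same
  height, hence the same branch, and `2 • (X + t e₀) = 2 • X + 2t e₀`);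
* the band profile is a slab profile (`bandExt_bound`, `bandExt_div_slab`, `bandExt_euler_slab` of
  `…SlabOfBand.lean` / `…BandTools.lean`);
* the dyadic extension `X ↦ V (2^{-⌊log₂ X₃⌋} X)` satisfies the ten crux clauses (helpers `slabExt_*` of
  `…SlabExtension.lean`, proof of `stub_slabExtension` re-run with the witnesses in scope) and is `x`-independent on
  the half-space (`noXCell_ext_invariant`: same exponent, rescaled point at height in `[1, 2) ⊂ (1/2, 4)`).
The resulting `x`-independent half-space hierarchy contradicts the landed negative lemma
`Theorems.not_xIndependentHalfSpaceHierarchy` (file `Theorems/HalfSpaceHierarchy/Negative/XIndependent.lean`, used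
through its let-free alias `HalfSpaceHierarchy.stub_notXIndependent`).  Folklore bookkeeping around that lemma.
-/

-- `Summit.<Summit>.<Problem>` is the tree's mandated summit-side namespace (CONVENTIONS §2); for this
-- single-conjunct summit the two coincide, so the duplicate is deliberate.
set_option linter.dupNamespace false

open scoped BigOperators Topology InnerProductSpace
open MeasureTheory Filter Set

noncomputable section

namespace Summit.AnomalousDissipation.AnomalousDissipation.Theorems.HalfSpaceHierarchy

/-! ### Horizontal translations commute with the gluing and with the dyadic extension -/

/-- **The gluing preserves `x`-independence.**  If `u` is invariant under `X ↦ X + t e₀` on `{1-η < z < 2+η}`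
(`0 < η`), then its three-piece gluing `v` (`u (2 •)` below `z = 1`, `u` on `1 ≤ z ≤ 2`, `u (2⁻¹ •)` above `z = 2`)
is invariant under `X ↦ X + t e₀` on the slab `{1/2 < z < 4}`: the translate has the same height, hence falls in the
same branch, and `c • (X + t e₀) = c • X + (c t) e₀` with `c • X` at a height in `(1, 2)`. -/
theorem noXCell_glue_invariant {α : Type*} {u v : EuclideanSpace ℝ (Fin 3) → α} {η : ℝ} (hη : 0 < η)
    (hv1 : ∀ X : EuclideanSpace ℝ (Fin 3), X 2 < 1 → v X = u ((2 : ℝ) • X))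
    (hv2 : ∀ X : EuclideanSpace ℝ (Fin 3), 1 ≤ X 2 → X 2 ≤ 2 → v X = u X)
    (hv3 : ∀ X : EuclideanSpace ℝ (Fin 3), 2 < X 2 → v X = u ((2 : ℝ)⁻¹ • X))
    (hx : ∀ (X : EuclideanSpace ℝ (Fin 3)) (t : ℝ), 1 - η < X 2 → X 2 < 2 + η →
      u (X + t • EuclideanSpace.single 0 (1 : ℝ)) = u X)
    {X : EuclideanSpace ℝ (Fin 3)} (h1 : 1 / 2 < X 2) (h2 : X 2 < 4) (t : ℝ) :
    v (X + t • EuclideanSpace.single 0 (1 : ℝ)) = v X := by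
  have hXt : (X + t • EuclideanSpace.single 0 (1 : ℝ) : EuclideanSpace ℝ (Fin 3)) 2 = X 2 := by simp
  have h2X : ((2 : ℝ) • X) 2 = 2 * X 2 := by simp
  have hX2 : ((2 : ℝ)⁻¹ • X) 2 = 2⁻¹ * X 2 := by simp
  by_cases hlt : X 2 < 1
  · rw [hv1 _ (by rw [hXt]; exact hlt), hv1 X hlt, smul_add, smul_smul]
    exact hx _ _ (by rw [h2X]; linarith) (by rw [h2X]; linarith)
  · by_cases hle : X 2 ≤ 2
    · rw [hv2 _ (by rw [hXt]; exact not_lt.mp hlt) (by rw [hXt]; exact hle), hv2 X (not_lt.mp hlt) hle]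
      exact hx X t (by linarith [not_lt.mp hlt]) (by linarith)
    · push Not at hlt hle
      rw [hv3 _ (by rw [hXt]; exact hle), hv3 X hle, smul_add, smul_smul]
      exact hx _ _ (by rw [hX2]; linarith) (by rw [hX2]; linarith)

/-- **The dyadic extension preserves `x`-independence.**  If `f` is invariant under `X ↦ X + t e₀` on the slab
`{1/2 < z < 4}`, then so is its dyadic extension `X ↦ f (2^{-⌊log₂ X₃⌋} X)` on the half-space `{0 < z}`: the
translate has the same height (same exponent), `c • (X + t e₀) = c • X + (c t) e₀`, and the rescaled point `c • X`
lies at a height in `[1, 2)` (`slabExt_rescale_mem`). -/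
theorem noXCell_ext_invariant {α : Type*} (f : EuclideanSpace ℝ (Fin 3) → α)
    (hx : ∀ (X : EuclideanSpace ℝ (Fin 3)) (t : ℝ), 1 / 2 < X 2 → X 2 < 4 →
      f (X + t • EuclideanSpace.single 0 (1 : ℝ)) = f X)
    {X : EuclideanSpace ℝ (Fin 3)} (hX : 0 < X 2) (t : ℝ) :
    f (((2 : ℝ) ^ Int.log 2 ((X + t • EuclideanSpace.single 0 (1 : ℝ) : EuclideanSpace ℝ (Fin 3)) 2))⁻¹ •
        (X + t • EuclideanSpace.single 0 (1 : ℝ))) =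
      f (((2 : ℝ) ^ Int.log 2 (X 2))⁻¹ • X) := by
  have hXt : (X + t • EuclideanSpace.single 0 (1 : ℝ) : EuclideanSpace ℝ (Fin 3)) 2 = X 2 := by simp
  obtain ⟨r1, r2⟩ := slabExt_rescale_mem hX
  rw [hXt, smul_add, smul_smul]
  exact hx _ _ (by linarith) (by linarith)

/-! ### The registered negative tool stub -/

/-- **Stub `stub_noXIndependentCellJunction` (line `bernoulli-surface-topology`; registered negative tool): there is
no `x`-independent cell junction.**  Given the data of `stub_cellJunction` together with the invariance of `(U, P)`
under `X ↦ X + t e₀` on `{1-η < z < 2+η}`, the explicit reduction of the line — consumed-form fluxes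
(`stub_fluxHeightInvariance`, `stub_halfScaleTrace`), three-piece gluing (`cellToBand_*`), slab upgrade
(`bandExt_bound`, `bandExt_div_slab`, `bandExt_euler_slab`), dyadic extension (`slabExt_*`) — produces a half-space
hierarchy which is still `x`-independent (`noXCell_glue_invariant`, `noXCell_ext_invariant`), contradicting
`Theorems.not_xIndependentHalfSpaceHierarchy` (through its let-free alias `stub_notXIndependent`). -/
theorem stub_noXIndependentCellJunction :
    ¬ (∃ (G : EuclideanSpace ℝ (Fin 3) → EuclideanSpace ℝ (Fin 3)) (PG : EuclideanSpace ℝ (Fin 3) → ℝ)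
        (U : EuclideanSpace ℝ (Fin 3) → EuclideanSpace ℝ (Fin 3)) (P : EuclideanSpace ℝ (Fin 3) → ℝ) (F η : ℝ),
        ContDiff ℝ ((⊤ : ℕ∞) : WithTop ℕ∞) G ∧ ContDiff ℝ ((⊤ : ℕ∞) : WithTop ℕ∞) PG ∧
        (∀ X : EuclideanSpace ℝ (Fin 3), ∑ i : Fin 3, (fderiv ℝ G X (EuclideanSpace.single i (1 : ℝ))) i = 0) ∧
        (∀ X : EuclideanSpace ℝ (Fin 3), (fderiv ℝ G X) (G X) + gradient PG X = 0) ∧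
        (∀ X : EuclideanSpace ℝ (Fin 3),
          G (X + EuclideanSpace.single 0 (1 : ℝ)) = G X ∧ G (X + EuclideanSpace.single 1 (1 : ℝ)) = G X ∧
          PG (X + EuclideanSpace.single 0 (1 : ℝ)) = PG X ∧ PG (X + EuclideanSpace.single 1 (1 : ℝ)) = PG X) ∧
        (∫ q in Set.Icc (0 : ℝ) 1 ×ˢ Set.Icc (0 : ℝ) 1, (G !₂[q.1, q.2, (0 : ℝ)]) 2 = 0) ∧ F ≠ 0 ∧
        (∫ q in Set.Icc (0 : ℝ) 1 ×ˢ Set.Icc (0 : ℝ) 1,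
          (G !₂[q.1, q.2, (0 : ℝ)]) 2 * (‖G !₂[q.1, q.2, (0 : ℝ)]‖ ^ 2 / 2 + PG !₂[q.1, q.2, (0 : ℝ)]) = F) ∧
        0 < η ∧ η < 1 / 2 ∧
        ContDiffOn ℝ ((⊤ : ℕ∞) : WithTop ℕ∞) U {Y : EuclideanSpace ℝ (Fin 3) | 1 - η < Y 2 ∧ Y 2 < 2 + η} ∧
        ContDiffOn ℝ ((⊤ : ℕ∞) : WithTop ℕ∞) P {Y : EuclideanSpace ℝ (Fin 3) | 1 - η < Y 2 ∧ Y 2 < 2 + η} ∧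
        (∀ X : EuclideanSpace ℝ (Fin 3), 1 < X 2 → X 2 < 2 →
          ∑ i : Fin 3, (fderiv ℝ U X (EuclideanSpace.single i (1 : ℝ))) i = 0) ∧
        (∀ X : EuclideanSpace ℝ (Fin 3), 1 < X 2 → X 2 < 2 → (fderiv ℝ U X) (U X) + gradient P X = 0) ∧
        (∀ X : EuclideanSpace ℝ (Fin 3), 1 ≤ X 2 → X 2 ≤ 2 →
          U (X + EuclideanSpace.single 0 (1 : ℝ)) = U X ∧ U (X + EuclideanSpace.single 1 (1 : ℝ)) = U X ∧
          P (X + EuclideanSpace.single 0 (1 : ℝ)) = P X ∧ P (X + EuclideanSpace.single 1 (1 : ℝ)) = P X) ∧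
        (∀ X : EuclideanSpace ℝ (Fin 3), 2 - η < X 2 → X 2 < 2 + η → U X = G X ∧ P X = PG X) ∧
        (∀ X : EuclideanSpace ℝ (Fin 3), 1 - η < X 2 → X 2 < 1 + η →
          U X = G ((2 : ℝ) • X) ∧ P X = PG ((2 : ℝ) • X)) ∧
        (∀ (X : EuclideanSpace ℝ (Fin 3)) (t : ℝ), 1 - η < X 2 → X 2 < 2 + η →
          U (X + t • EuclideanSpace.single 0 (1 : ℝ)) = U X ∧
          P (X + t • EuclideanSpace.single 0 (1 : ℝ)) = P X)) := by
  rintro ⟨G, PG, U, P, F, η, hG, hPG, hGdiv, hGE, hGper, hGm, hF, hGe, hη, -, hU, hP, hUdiv, hUE, hUper,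
    htop, hbot, hx⟩
  /- (1) Consumed-form fluxes of the conduit array at the bottom trace `q ↦ 2 • (q₁, q₂, 1)`. -/
  obtain ⟨hmass0, henergy0⟩ := stub_fluxHeightInvariance G PG hG hPG hGdiv hGE hGper 0 2
  have hGc : Continuous G := hG.continuous
  have hPGc : Continuous PG := hPG.continuous
  have h3 : Continuous fun X : EuclideanSpace ℝ (Fin 3) => (G X) 2 :=
    (continuous_apply 2).comp ((PiLp.continuous_ofLp 2 _).comp hGc)
  have hBc : Continuous fun X : EuclideanSpace ℝ (Fin 3) => (G X) 2 * (‖G X‖ ^ 2 / 2 + PG X) :=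
    h3.mul (((hGc.norm.pow 2).div_const 2).add hPGc)
  have hper3 : ∀ X : EuclideanSpace ℝ (Fin 3),
      (fun Y : EuclideanSpace ℝ (Fin 3) => (G Y) 2) (X + EuclideanSpace.single 0 (1 : ℝ)) =
        (fun Y : EuclideanSpace ℝ (Fin 3) => (G Y) 2) X ∧
      (fun Y : EuclideanSpace ℝ (Fin 3) => (G Y) 2) (X + EuclideanSpace.single 1 (1 : ℝ)) =
        (fun Y : EuclideanSpace ℝ (Fin 3) => (G Y) 2) X := by
    intro X
    simp only [(hGper X).1, (hGper X).2.1, and_self]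
  have hperB : ∀ X : EuclideanSpace ℝ (Fin 3),
      (fun Y : EuclideanSpace ℝ (Fin 3) => (G Y) 2 * (‖G Y‖ ^ 2 / 2 + PG Y)) (X + EuclideanSpace.single 0 (1 : ℝ)) =
        (fun Y : EuclideanSpace ℝ (Fin 3) => (G Y) 2 * (‖G Y‖ ^ 2 / 2 + PG Y)) X ∧
      (fun Y : EuclideanSpace ℝ (Fin 3) => (G Y) 2 * (‖G Y‖ ^ 2 / 2 + PG Y)) (X + EuclideanSpace.single 1 (1 : ℝ)) =
        (fun Y : EuclideanSpace ℝ (Fin 3) => (G Y) 2 * (‖G Y‖ ^ 2 / 2 + PG Y)) X := by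
    intro X
    simp only [(hGper X).1, (hGper X).2.1, (hGper X).2.2.1, (hGper X).2.2.2, and_self]
  have hm : (∫ q in Set.Icc (0 : ℝ) 1 ×ˢ Set.Icc (0 : ℝ) 1, (G ((2 : ℝ) • !₂[q.1, q.2, (1 : ℝ)])) 2) = 0 := by
    have key := stub_halfScaleTrace (fun Y : EuclideanSpace ℝ (Fin 3) => (G Y) 2) h3 hper3
    simp only [] at key
    rw [key, hmass0, hGm]
  have he : (∫ q in Set.Icc (0 : ℝ) 1 ×ˢ Set.Icc (0 : ℝ) 1,
      (G ((2 : ℝ) • !₂[q.1, q.2, (1 : ℝ)])) 2 *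
        (‖G ((2 : ℝ) • !₂[q.1, q.2, (1 : ℝ)])‖ ^ 2 / 2 + PG ((2 : ℝ) • !₂[q.1, q.2, (1 : ℝ)]))) = F := by
    have key := stub_halfScaleTrace (fun Y : EuclideanSpace ℝ (Fin 3) => (G Y) 2 * (‖G Y‖ ^ 2 / 2 + PG Y)) hBc hperB
    simp only [] at key
    rw [key, henergy0, hGe]
  /- (2) The glued band profile `(V, Q)` on the slab `{1/2 < z < 4}`, kept in scope. -/
  obtain ⟨V, hV1, hV2, hV3⟩ := cellToBand_exists_glue U
  obtain ⟨Q, hQ1, hQ2, hQ3⟩ := cellToBand_exists_glue P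
  have htopU : ∀ X : EuclideanSpace ℝ (Fin 3), 2 - η < X 2 → X 2 < 2 + η → U X = G X :=
    fun X a b => (htop X a b).1
  have htopP : ∀ X : EuclideanSpace ℝ (Fin 3), 2 - η < X 2 → X 2 < 2 + η → P X = PG X :=
    fun X a b => (htop X a b).2
  have hbotU : ∀ X : EuclideanSpace ℝ (Fin 3), 1 - η < X 2 → X 2 < 1 + η → U X = G ((2 : ℝ) • X) :=
    fun X a b => (hbot X a b).1
  have hbotP : ∀ X : EuclideanSpace ℝ (Fin 3), 1 - η < X 2 → X 2 < 1 + η → P X = PG ((2 : ℝ) • X) :=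
    fun X a b => (hbot X a b).2
  have hV : ContDiffOn ℝ ((⊤ : ℕ∞) : WithTop ℕ∞) V {Y : EuclideanSpace ℝ (Fin 3) | 1 / 2 < Y 2 ∧ Y 2 < 4} :=
    cellToBand_contDiffOn hη hU htopU hbotU hV1 hV2 hV3
  have hQ : ContDiffOn ℝ ((⊤ : ℕ∞) : WithTop ℕ∞) Q {Y : EuclideanSpace ℝ (Fin 3) | 1 / 2 < Y 2 ∧ Y 2 < 4} :=
    cellToBand_contDiffOn hη hP htopP hbotP hQ1 hQ2 hQ3
  have hdivB : ∀ X : EuclideanSpace ℝ (Fin 3), 1 < X 2 → X 2 < 2 →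
      ∑ i : Fin 3, (fderiv ℝ V X (EuclideanSpace.single i (1 : ℝ))) i = 0 := by
    intro X h1 h2
    rw [(cellToBand_eventuallyEq hV2 h1 h2).fderiv_eq]
    exact hUdiv X h1 h2
  have hEB : ∀ X : EuclideanSpace ℝ (Fin 3), 1 < X 2 → X 2 < 2 → (fderiv ℝ V X) (V X) + gradient Q X = 0 := by
    intro X h1 h2
    rw [(cellToBand_eventuallyEq hV2 h1 h2).fderiv_eq, hV2 X h1.le h2.le, cellToBand_gradient hQ2 h1 h2]
    exact hUE X h1 h2
  have hdil : ∀ X : EuclideanSpace ℝ (Fin 3), 1 / 2 < X 2 → X 2 < 2 →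
      V ((2 : ℝ) • X) = V X ∧ Q ((2 : ℝ) • X) = Q X := fun X h1 h2 =>
    ⟨cellToBand_dilation hη htopU hbotU hV1 hV2 hV3 h1 h2, cellToBand_dilation hη htopP hbotP hQ1 hQ2 hQ3 h1 h2⟩
  have hper : ∀ X : EuclideanSpace ℝ (Fin 3), 1 ≤ X 2 → X 2 ≤ 2 →
      V (X + EuclideanSpace.single 0 (1 : ℝ)) = V X ∧ V (X + EuclideanSpace.single 1 (1 : ℝ)) = V X ∧
      Q (X + EuclideanSpace.single 0 (1 : ℝ)) = Q X ∧ Q (X + EuclideanSpace.single 1 (1 : ℝ)) = Q X := by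
    intro X h1 h2
    obtain ⟨a, b, c, d⟩ := hUper X h1 h2
    exact ⟨cellToBand_periodic hV2 (EuclideanSpace.single 0 (1 : ℝ)) (by simp) h1 h2 a,
      cellToBand_periodic hV2 (EuclideanSpace.single 1 (1 : ℝ)) (by simp) h1 h2 b,
      cellToBand_periodic hQ2 (EuclideanSpace.single 0 (1 : ℝ)) (by simp) h1 h2 c,
      cellToBand_periodic hQ2 (EuclideanSpace.single 1 (1 : ℝ)) (by simp) h1 h2 d⟩
  have hmass : (∫ q in Set.Icc (0 : ℝ) 1 ×ˢ Set.Icc (0 : ℝ) 1, (V !₂[q.1, q.2, (1 : ℝ)]) 2) = 0 := by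
    simp_rw [cellToBand_trace hη hbotU hV2]
    exact hm
  have hflux : (∫ q in Set.Icc (0 : ℝ) 1 ×ˢ Set.Icc (0 : ℝ) 1,
      (V !₂[q.1, q.2, (1 : ℝ)]) 2 * (‖V !₂[q.1, q.2, (1 : ℝ)]‖ ^ 2 / 2 + Q !₂[q.1, q.2, (1 : ℝ)])) = F := by
    simp_rw [cellToBand_trace hη hbotU hV2, cellToBand_trace hη hbotP hQ2]
    exact he
  -- NEW: `x`-independence survives the gluing
  have hxV : ∀ (X : EuclideanSpace ℝ (Fin 3)) (t : ℝ), 1 / 2 < X 2 → X 2 < 4 →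
      V (X + t • EuclideanSpace.single 0 (1 : ℝ)) = V X := fun X t a b =>
    noXCell_glue_invariant hη hV1 hV2 hV3 (fun Y s c d => (hx Y s c d).1) a b t
  have hxQ : ∀ (X : EuclideanSpace ℝ (Fin 3)) (t : ℝ), 1 / 2 < X 2 → X 2 < 4 →
      Q (X + t • EuclideanSpace.single 0 (1 : ℝ)) = Q X := fun X t a b =>
    noXCell_glue_invariant hη hQ1 hQ2 hQ3 (fun Y s c d => (hx Y s c d).2) a b t
  /- (3) Slab upgrade: bounds, divergence and Euler on the whole slab. -/
  obtain ⟨C, hB⟩ := bandExt_bound V Q hV.continuousOn hQ.continuousOn hdil hper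
  have hdiv := bandExt_div_slab V hV (fun Y a b => (hdil Y a b).1) hdivB
  have hE := bandExt_euler_slab V Q hV hQ hdil hEB
  /- (4) Dyadic extension `X ↦ (V, Q) (2^{-⌊log₂ X₃⌋} X)`: the ten crux clauses (as in `stub_slabExtension`)
  and `x`-independence on the half-space, against `stub_notXIndependent`. -/
  have hdilV : ∀ Y : EuclideanSpace ℝ (Fin 3), 1 / 2 < Y 2 → Y 2 < 2 → V ((2 : ℝ) • Y) = V Y :=
    fun Y h1 h2 => (hdil Y h1 h2).1
  have hdilQ : ∀ Y : EuclideanSpace ℝ (Fin 3), 1 / 2 < Y 2 → Y 2 < 2 → Q ((2 : ℝ) • Y) = Q Y :=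
    fun Y h1 h2 => (hdil Y h1 h2).2
  -- the rescaled point lies in the slab
  have hS : ∀ X : EuclideanSpace ℝ (Fin 3), 0 < X 2 →
      ((2 : ℝ) ^ Int.log 2 (X 2))⁻¹ • X ∈ {Y : EuclideanSpace ℝ (Fin 3) | 1 / 2 < Y 2 ∧ Y 2 < 4} := by
    intro X hX
    obtain ⟨h1, h2⟩ := slabExt_rescale_mem hX
    exact ⟨by linarith, by linarith⟩
  -- on `1/2 < z < 4` the extension is the original function (agreement with `k = 0`)
  have hagree : ∀ (α : Type) (f : EuclideanSpace ℝ (Fin 3) → α),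
      (∀ Y : EuclideanSpace ℝ (Fin 3), 1 / 2 < Y 2 → Y 2 < 2 → f ((2 : ℝ) • Y) = f Y) →
      ∀ X : EuclideanSpace ℝ (Fin 3), 1 / 2 < X 2 → X 2 < 4 → f (((2 : ℝ) ^ Int.log 2 (X 2))⁻¹ • X) = f X := by
    intro α f hf X h1 h2
    have h := slabExt_agree f hf (k := 0) (X := X) (by norm_num; exact h1) (by norm_num; exact h2)
    simpa using h
  -- the trace at `z = 1` is untouched
  have hpt : ∀ q : ℝ × ℝ, ((2 : ℝ) ^ Int.log 2 ((!₂[q.1, q.2, (1 : ℝ)] : EuclideanSpace ℝ (Fin 3)) 2))⁻¹ •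
      (!₂[q.1, q.2, (1 : ℝ)] : EuclideanSpace ℝ (Fin 3)) = !₂[q.1, q.2, (1 : ℝ)] := by
    intro q
    have h1 : (!₂[q.1, q.2, (1 : ℝ)] : EuclideanSpace ℝ (Fin 3)) 2 = 1 := by simp
    rw [h1, Int.log_one_right, zpow_zero, inv_one, one_smul]
  refine stub_notXIndependent ⟨fun X => V (((2 : ℝ) ^ Int.log 2 (X 2))⁻¹ • X),
    fun X => Q (((2 : ℝ) ^ Int.log 2 (X 2))⁻¹ • X), C, F, ?_, ?_⟩
  · refine ⟨slabExt_contDiffOn V hV hdilV, slabExt_contDiffOn Q hQ hdilQ, fun X hX => hB _ (hS X hX),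
      ?_, ?_, ?_, ?_, ?_, hF, ?_⟩
    · -- divergence free
      intro X hX
      have hX' : 0 < X 2 := hX
      simp only [slabExt_fderiv V hV hdilV hX', _root_.smul_apply, PiLp.smul_apply,
        smul_eq_mul, ← Finset.mul_sum]
      rw [hdiv _ (hS X hX'), mul_zero]
    · -- steady Euler: both terms scale by `2^{-k}`
      intro X hX
      have hX' : 0 < X 2 := hX
      rw [slabExt_fderiv V hV hdilV hX', slabExt_gradient Q hQ hdilQ hX', _root_.smul_apply,
        ← smul_add, hE _ (hS X hX'), smul_zero]
    · -- dilation invariance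
      intro X hX
      have hX' : 0 < X 2 := hX
      have hm1 := slabExt_zpow_log_le hX'
      have hm2 := slabExt_lt_zpow_log_succ (X 2)
      have h2X : ((2 : ℝ) • X) 2 = 2 * X 2 := by simp
      have hb1 : (2 : ℝ) ^ (Int.log 2 (X 2) - 1) < ((2 : ℝ) • X) 2 := by
        rw [h2X, zpow_sub_one₀ two_ne_zero]
        nlinarith [zpow_pos (two_pos : (0 : ℝ) < 2) (Int.log 2 (X 2))]
      have hb2 : ((2 : ℝ) • X) 2 < (2 : ℝ) ^ (Int.log 2 (X 2) + 2) := by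
        rw [h2X]
        have : (2 : ℝ) ^ (Int.log 2 (X 2) + 2) = 2 * (2 : ℝ) ^ (Int.log 2 (X 2) + 1) := by
          rw [show Int.log 2 (X 2) + 2 = Int.log 2 (X 2) + 1 + 1 by ring, zpow_add_one₀ two_ne_zero]
          ring
        rw [this]
        linarith
      have key : ∀ (α : Type) (f : EuclideanSpace ℝ (Fin 3) → α),
          (∀ Y : EuclideanSpace ℝ (Fin 3), 1 / 2 < Y 2 → Y 2 < 2 → f ((2 : ℝ) • Y) = f Y) →
          f (((2 : ℝ) ^ Int.log 2 (((2 : ℝ) • X) 2))⁻¹ • ((2 : ℝ) • X)) =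
            f (((2 : ℝ) ^ Int.log 2 (X 2))⁻¹ • X) := by
        intro α f hf
        rw [slabExt_agree f hf hb1 hb2, smul_comm]
        obtain ⟨r1, r2⟩ := slabExt_rescale_mem hX'
        exact hf _ (by linarith) r2
      exact ⟨key _ V hdilV, key _ Q hdilQ⟩
    · -- horizontal periodicity on the band `1 ≤ z ≤ 2`
      intro X h1 h2
      beta_reduce
      have e0 : (X + EuclideanSpace.single (0 : Fin 3) (1 : ℝ) : EuclideanSpace ℝ (Fin 3)) 2 = X 2 := by simp
      have e1 : (X + EuclideanSpace.single (1 : Fin 3) (1 : ℝ) : EuclideanSpace ℝ (Fin 3)) 2 = X 2 := by simp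
      have hXa : 1 / 2 < X 2 := by linarith
      have hXb : X 2 < 4 := by linarith
      rw [hagree _ V hdilV X hXa hXb, hagree _ Q hdilQ X hXa hXb,
        hagree _ V hdilV _ (by rw [e0]; exact hXa) (by rw [e0]; exact hXb),
        hagree _ V hdilV _ (by rw [e1]; exact hXa) (by rw [e1]; exact hXb),
        hagree _ Q hdilQ _ (by rw [e0]; exact hXa) (by rw [e0]; exact hXb),
        hagree _ Q hdilQ _ (by rw [e1]; exact hXa) (by rw [e1]; exact hXb)]
      exact hper X h1 h2
    · -- zero mass flux through the unit square of `z = 1`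
      simp_rw [hpt]
      exact hmass
    · -- the energy flux is `F`
      simp_rw [hpt]
      exact hflux
  · -- NEW: `x`-independence survives the dyadic extension
    intro X t hX
    exact ⟨noXCell_ext_invariant V hxV hX t, noXCell_ext_invariant Q hxQ hX t⟩

end Summit.AnomalousDissipation.AnomalousDissipation.Theorems.HalfSpaceHierarchy

end
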